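import Literature.AlgebraicTopology.SingularHomology.CupProductExteriorH1
import Mathlib.LinearAlgebra.TensorProduct.Map
import HarnessLib

/-!
# COR-CM model layer (row M22 `Fact_algDuality`, clause (ii)): the intertwining identity for the
# Fourier-type operators `z ↦ Σ_c τ(z ⌣ m_i(b ∘ c)) • m_i(y ∘ c)`

Cell `pub-hodgecm2` (COR-CM = stage 2 of the Hodge ladder), seat `b22` (M22 reserve).  HONEST FRAMING:
a piece of GRADED MULTILINEAR ALGEBRA on the real singular-cohomology carriers of an arbitrary
topological space; nothing about algebraic cycles or Hodge classes is asserted.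

Row M22 of `BINDER-OWNERS.md` (= stage-1 `ModelAxioms` field 28 `Fact_algDuality`,
`CorCM/Geometry/Facts.lean`) asks, for the product `P` of the four corner CM abelian varieties, for a
`ℚ`-linear bijection `D : H^{2d-4}(P, ℚ) → H⁴(P, ℚ)` which (i) maps algebraic classes to algebraic classes
and (ii) INTERTWINES the diagonal action of `a ∈ K` with the inverse-conjugate action up to the degree:
`ā^* ∘ D ∘ a^* = N_{K/ℚ}(a)⁴ · D`.  The cell's plan (lead 18:41:53Z, model-1 18:52:18Z) takes for `D` the
Betti transcription of the tree's abstract `Motives.WeilCohomology.fourierOp`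
(`Motives/AbelianVarietyExterior.lean`):

  `D z = Σ_{c : Fin i → Fin N} τ(z ⌣ m_i(b ∘ c)) • m_i(y ∘ c)`,

`m_i` the iterated cup product of degree-one classes (the tree's `SingularHomology.cupPowOne`), `b`, `y`
two families of degree-one classes, `τ` a linear functional on the top cohomology (a trace).  This file
proves clause (ii) for every operator of this shape, in the following ROUTE-NEUTRAL form (no
polarization, no group law, no Künneth decomposition is used):

* `sum_cupPowOne_tmul_cupPowOne_eq` — the tensor `Σ_c m_i(b ∘ c) ⊗ m_i(y ∘ c) ∈ Hⁱ ⊗ Hⁱ` depends only on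
  the degree-one tensor `Σ_a b_a ⊗ y_a ∈ H¹ ⊗ H¹` (induction on `i`: the step is the linear map
  `v ⊗ w ↦ (v ⌣ –) ⊗ (w ⌣ –)` applied to it);
* `fourierSum_eq_of_sum_tmul_eq` — hence so does the operator `z ↦ Σ_c τ(z ⌣ m_i(b ∘ c)) • m_i(y ∘ c)`;
* `map_fourierSum_map_eq_smul` — **the intertwining identity**: for continuous self-maps `F`, `G` with
  `τ ∘ F^* = λ • τ` (degree of `F`), a family `b'` with `F^* b'_a = b_a`, and the tensor identity
  `Σ_a b'_a ⊗ G^* y_a = Σ_a b_a ⊗ y_a`, one has `G^*(D(F^* z)) = λ • D z`;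
* `map_fourierSum_map_eq_smul_of_rosati` — the same from the hypotheses in which they arise on the
  model: `F^*` acts on `H¹` through a linear AUTOMORPHISM `α` and the ROSATI TENSOR IDENTITY
  `Σ_a α b_a ⊗ y_a = Σ_a b_a ⊗ G^* y_a` holds (on the model: `F = Ma`, `G = Mb` act diagonally by `a`, `ā`;
  `α = ⊕ᵢ ι_i(a)`; `λ = N_{K/ℚ}(a)⁴` is row M19 `Fact_deg_diag`; the tensor identity is the Rosati
  condition "the Rosati involution of the polarization induces complex conjugation on `K`" for the pair
  of `Q`-dual bases `(b, y)`).

Print shape of the argument: Kleiman, *Algebraic cycles and the Weil conjectures* (1968) App. 2A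
(2A9–2A11: the operators induced by the powers of the Poincaré class); Lange, *Abelian Varieties over
the Complex Numbers* (2023) Prop. 6.2.20 / §6.2.4; Mukai's formula `α̂^* ∘ 𝓕 ∘ α^* = deg(α) · 𝓕` for an
isogeny `α` (Beauville, LNM 1016 (1983), Prop. 1) — here in the elementary form "an operator written in a
pair of dual bases is equivariant for a pair of mutually adjoint automorphisms".
-/

noncomputable section

open Literature.AlgebraicTopology.SingularHomology
open scoped TensorProduct

universe u v

namespace Summit.HodgeConjecture.CorCM.Model

variable {R : Type v} [CommRing R] {Y : Type u} [TopologicalSpace Y]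

/-! ### Reindexing sums over tuples -/

/-- Reindexing a sum over `(i+1)`-tuples by the first entry and the tail. [folklore] -/
theorem sum_tuple_succ_eq_sum_sum_cons {M : Type*} [AddCommMonoid M] {i N : ℕ}
    (G : (Fin (i + 1) → Fin N) → M) :
    ∑ c : Fin (i + 1) → Fin N, G c = ∑ a : Fin N, ∑ c : Fin i → Fin N, G (Fin.cons a c) := by
  rw [← Fintype.sum_prod_type (f := fun p : Fin N × (Fin i → Fin N) => G (Fin.cons p.1 p.2))]
  exact (Fintype.sum_equiv (Fin.consEquiv fun _ : Fin (i + 1) => Fin N) _ _ fun _ => rfl).symm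

/-! ### The tensor `Σ_c m_i(b ∘ c) ⊗ m_i(y ∘ c)` depends only on `Σ_a b_a ⊗ y_a` -/

/-- One induction step: `Σ_{c : Fin (i+1) → Fin N} m_{i+1}(b ∘ c) ⊗ m_{i+1}(y ∘ c)` is the image of
`Σ_{c : Fin i → Fin N} m_i(b ∘ c) ⊗ m_i(y ∘ c)` under the linear map attached to `Σ_a b_a ⊗ y_a` by
`v ⊗ w ↦ (v ⌣ –) ⊗ (w ⌣ –)` (Mathlib's `TensorProduct.map₂` of two copies of the cup product).
[folklore] -/
theorem sum_cupPowOne_tmul_cupPowOne_succ {N : ℕ} (b y : Fin N → singularCohomology R R Y 1) (i : ℕ) :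
    ∑ c : Fin (i + 1) → Fin N, cupPowOne R Y (i + 1) (b ∘ c) ⊗ₜ[R] cupPowOne R Y (i + 1) (y ∘ c) =
      TensorProduct.map₂ (cupProduct (R := R) (X := Y) (Nat.add_comm 1 i))
          (cupProduct (R := R) (X := Y) (Nat.add_comm 1 i))
        (∑ a : Fin N, b a ⊗ₜ[R] y a)
        (∑ c : Fin i → Fin N, cupPowOne R Y i (b ∘ c) ⊗ₜ[R] cupPowOne R Y i (y ∘ c)) := by
  rw [sum_tuple_succ_eq_sum_sum_cons,
    map_sum (TensorProduct.map₂ (cupProduct (R := R) (X := Y) (Nat.add_comm 1 i))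
      (cupProduct (R := R) (X := Y) (Nat.add_comm 1 i))),
    LinearMap.sum_apply]
  refine Finset.sum_congr rfl fun a _ => ?_
  rw [TensorProduct.map₂_apply_tmul, map_sum (TensorProduct.map _ _)]
  refine Finset.sum_congr rfl fun c _ => ?_
  rw [TensorProduct.map_tmul, Fin.comp_cons, Fin.comp_cons, ← cupProduct_cupPowOne,
    ← cupProduct_cupPowOne]

/-- **`Σ_c m_i(b ∘ c) ⊗ m_i(y ∘ c)` depends only on `Σ_a b_a ⊗ y_a`.**  For two pairs of families of
degree-one classes with the same degree-one tensor, the degree-`i` tensors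
`Σ_{c : Fin i → Fin N} m_i(b ∘ c) ⊗ m_i(y ∘ c) ∈ Hⁱ(Y; R) ⊗ Hⁱ(Y; R)` agree (induction on `i`; both are the
value at `(t, …, t)`, `t = Σ_a b_a ⊗ y_a`, of one multilinear map). [folklore] -/
theorem sum_cupPowOne_tmul_cupPowOne_eq {N N' : ℕ} (b y : Fin N → singularCohomology R R Y 1)
    (b' y' : Fin N' → singularCohomology R R Y 1)
    (h : ∑ a : Fin N, b a ⊗ₜ[R] y a = ∑ a : Fin N', b' a ⊗ₜ[R] y' a) (i : ℕ) :
    ∑ c : Fin i → Fin N, cupPowOne R Y i (b ∘ c) ⊗ₜ[R] cupPowOne R Y i (y ∘ c) =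
      ∑ c : Fin i → Fin N', cupPowOne R Y i (b' ∘ c) ⊗ₜ[R] cupPowOne R Y i (y' ∘ c) := by
  induction i with
  | zero =>
    simp only [cupPowOne_zero, Finset.sum_const, Finset.card_univ, Fintype.card_pi,
      Finset.prod_const, Fintype.card_fin, pow_zero, one_smul]
  | succ i ih =>
    rw [sum_cupPowOne_tmul_cupPowOne_succ, sum_cupPowOne_tmul_cupPowOne_succ, h, ih]

/-! ### The Fourier-type sums `Σ_c τ(z ⌣ m_i(b ∘ c)) • m_i(y ∘ c)` -/

/-- The Fourier-type sum is the image of the tensor `Σ_c m_i(b ∘ c) ⊗ m_i(y ∘ c)` under the linear map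
`X ⊗ W ↦ τ(z ⌣ X) • W`. [folklore] -/
theorem fourierSum_eq_lift {N i j k : ℕ} (hk : j + i = k) (τ : singularCohomology R R Y k →ₗ[R] R)
    (b y : Fin N → singularCohomology R R Y 1) (z : singularCohomology R R Y j) :
    ∑ c : Fin i → Fin N, τ (cupProduct hk z (cupPowOne R Y i (b ∘ c))) • cupPowOne R Y i (y ∘ c) =
      TensorProduct.lift ((LinearMap.lsmul R (singularCohomology R R Y i)).comp (τ ∘ₗ cupProduct hk z))
        (∑ c : Fin i → Fin N, cupPowOne R Y i (b ∘ c) ⊗ₜ[R] cupPowOne R Y i (y ∘ c)) := by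
  rw [map_sum]
  refine Finset.sum_congr rfl fun c _ => ?_
  rw [TensorProduct.lift.tmul]
  rfl

/-- **The Fourier-type operator depends only on `Σ_a b_a ⊗ y_a`**: two pairs of families with the same
degree-one tensor define the same operator `z ↦ Σ_c τ(z ⌣ m_i(b ∘ c)) • m_i(y ∘ c)`. [folklore] -/
theorem fourierSum_eq_of_sum_tmul_eq {N N' i j k : ℕ} (hk : j + i = k)
    (τ : singularCohomology R R Y k →ₗ[R] R) (b y : Fin N → singularCohomology R R Y 1)
    (b' y' : Fin N' → singularCohomology R R Y 1)
    (h : ∑ a : Fin N, b a ⊗ₜ[R] y a = ∑ a : Fin N', b' a ⊗ₜ[R] y' a) (z : singularCohomology R R Y j) :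
    ∑ c : Fin i → Fin N, τ (cupProduct hk z (cupPowOne R Y i (b ∘ c))) • cupPowOne R Y i (y ∘ c) =
      ∑ c : Fin i → Fin N', τ (cupProduct hk z (cupPowOne R Y i (b' ∘ c))) • cupPowOne R Y i (y' ∘ c) := by
  rw [fourierSum_eq_lift, fourierSum_eq_lift, sum_cupPowOne_tmul_cupPowOne_eq b y b' y' h i]

/-! ### The intertwining identity -/

/-- **Intertwining identity for the Fourier-type operator** `D z = Σ_c τ(z ⌣ m_i(b ∘ c)) • m_i(y ∘ c)`.
Let `F, G : Y → Y` be continuous, `λ ∈ R` with `τ ∘ F^* = λ • τ` on `Hᵏ` ("`F` has degree `λ` for the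
trace `τ`"), and suppose `b = F^* ∘ b'` for a family `b'` with `Σ_a b'_a ⊗ G^* y_a = Σ_a b_a ⊗ y_a`.  Then
`G^*(D(F^* z)) = λ • D z` for every `z ∈ Hʲ(Y; R)`.  (Multiplicativity of `F^*`, `G^*` on the iterated
products — `map_cupPowOne`, `cupProduct_map` — reduces the claim to `fourierSum_eq_of_sum_tmul_eq`.)
[cite: Kleiman1968AlgebraicCycles, Appendix 2A, 2A9–2A11] -/
theorem map_fourierSum_map_eq_smul {N i j k : ℕ} (hk : j + i = k)
    (τ : singularCohomology R R Y k →ₗ[R] R) (F G : C(Y, Y)) (lam : R)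
    (hτ : τ ∘ₗ (singularCohomology.map R R F k).hom = lam • τ)
    (b y b' : Fin N → singularCohomology R R Y 1)
    (hb : ∀ a, singularCohomology.map R R F 1 (b' a) = b a)
    (hy : ∑ a : Fin N, b' a ⊗ₜ[R] singularCohomology.map R R G 1 (y a) = ∑ a : Fin N, b a ⊗ₜ[R] y a)
    (z : singularCohomology R R Y j) :
    singularCohomology.map R R G i
        (∑ c : Fin i → Fin N, τ (cupProduct hk (singularCohomology.map R R F j z) (cupPowOne R Y i (b ∘ c))) •
          cupPowOne R Y i (y ∘ c)) =
      lam • ∑ c : Fin i → Fin N, τ (cupProduct hk z (cupPowOne R Y i (b ∘ c))) • cupPowOne R Y i (y ∘ c) := by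
  -- `b ∘ c = F^* ∘ (b' ∘ c)`, so `m_i(b ∘ c) = F^* m_i(b' ∘ c)` and `τ(F^* z ⌣ F^* x) = λ τ(z ⌣ x)`.
  have hbc : ∀ c : Fin i → Fin N,
      cupPowOne R Y i (b ∘ c) = singularCohomology.map R R F i (cupPowOne R Y i (b' ∘ c)) := by
    intro c
    rw [map_cupPowOne]
    congr 1
    funext p
    exact (hb (c p)).symm
  have hτz : ∀ c : Fin i → Fin N,
      τ (cupProduct hk (singularCohomology.map R R F j z) (cupPowOne R Y i (b ∘ c))) =
        lam * τ (cupProduct hk z (cupPowOne R Y i (b' ∘ c))) := by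
    intro c
    rw [hbc c, ← cupProduct_map]
    have := LinearMap.congr_fun hτ (cupProduct hk z (cupPowOne R Y i (b' ∘ c)))
    simpa only [LinearMap.coe_comp, Function.comp_apply, LinearMap.smul_apply, smul_eq_mul] using this
  -- `G^* m_i(y ∘ c) = m_i((G^* ∘ y) ∘ c)`.
  have hyc : ∀ c : Fin i → Fin N,
      singularCohomology.map R R G i (cupPowOne R Y i (y ∘ c)) =
        cupPowOne R Y i ((fun a => singularCohomology.map R R G 1 (y a)) ∘ c) := by
    intro c
    rw [map_cupPowOne]
    rfl
  calc singularCohomology.map R R G i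
        (∑ c : Fin i → Fin N, τ (cupProduct hk (singularCohomology.map R R F j z) (cupPowOne R Y i (b ∘ c))) •
          cupPowOne R Y i (y ∘ c))
      = ∑ c : Fin i → Fin N, lam • (τ (cupProduct hk z (cupPowOne R Y i (b' ∘ c))) •
          cupPowOne R Y i ((fun a => singularCohomology.map R R G 1 (y a)) ∘ c)) := by
        rw [map_sum]
        refine Finset.sum_congr rfl fun c _ => ?_
        rw [map_smul, hτz c, hyc c, mul_smul]
    _ = lam • ∑ c : Fin i → Fin N, τ (cupProduct hk z (cupPowOne R Y i (b' ∘ c))) •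
          cupPowOne R Y i ((fun a => singularCohomology.map R R G 1 (y a)) ∘ c) := by
        rw [Finset.smul_sum]
    _ = lam • ∑ c : Fin i → Fin N, τ (cupProduct hk z (cupPowOne R Y i (b ∘ c))) • cupPowOne R Y i (y ∘ c) := by
        rw [fourierSum_eq_of_sum_tmul_eq hk τ b' (fun a => singularCohomology.map R R G 1 (y a)) b y hy z]

/-- **Intertwining identity, Rosati form.**  If `F^*` acts on `H¹(Y; R)` through a linear automorphism
`α` and the ROSATI TENSOR IDENTITY `Σ_a α b_a ⊗ y_a = Σ_a b_a ⊗ G^* y_a` holds in `H¹ ⊗ H¹` (i.e. `α` and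
`G^*|_{H¹}` are mutually adjoint for the bilinear form in which `b` and `y` are dual bases), and
`τ ∘ F^* = λ • τ` on `Hᵏ`, then `G^* ∘ D ∘ F^* = λ • D` for `D z = Σ_c τ(z ⌣ m_i(b ∘ c)) • m_i(y ∘ c)`.
On the COR-CM model (`Y = P(ℂ)`, `F = Ma`, `G = Mb` acting diagonally by `a`, `ā ∈ K`, `α = ⊕ᵢ ι_i(a)`,
`λ = N_{K/ℚ}(a)⁴` by `Fact_deg_diag`) this is clause (ii) of `Fact_algDuality`.
[cite: Kleiman1968AlgebraicCycles, Appendix 2A, 2A9–2A11] -/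
theorem map_fourierSum_map_eq_smul_of_rosati {N i j k : ℕ} (hk : j + i = k)
    (τ : singularCohomology R R Y k →ₗ[R] R) (F G : C(Y, Y)) (lam : R)
    (hτ : τ ∘ₗ (singularCohomology.map R R F k).hom = lam • τ)
    (α : singularCohomology R R Y 1 ≃ₗ[R] singularCohomology R R Y 1)
    (hα : ∀ x, singularCohomology.map R R F 1 x = α x)
    (b y : Fin N → singularCohomology R R Y 1)
    (hRos : ∑ a : Fin N, α (b a) ⊗ₜ[R] y a = ∑ a : Fin N, b a ⊗ₜ[R] singularCohomology.map R R G 1 (y a))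
    (z : singularCohomology R R Y j) :
    singularCohomology.map R R G i
        (∑ c : Fin i → Fin N, τ (cupProduct hk (singularCohomology.map R R F j z) (cupPowOne R Y i (b ∘ c))) •
          cupPowOne R Y i (y ∘ c)) =
      lam • ∑ c : Fin i → Fin N, τ (cupProduct hk z (cupPowOne R Y i (b ∘ c))) • cupPowOne R Y i (y ∘ c) := by
  refine map_fourierSum_map_eq_smul hk τ F G lam hτ b y (fun a => α.symm (b a))
    (fun a => by rw [hα, LinearEquiv.apply_symm_apply]) ?_ z
  -- apply `α⁻¹ ⊗ 1` to the Rosati identity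
  have := congrArg (TensorProduct.map (α.symm : singularCohomology R R Y 1 →ₗ[R] singularCohomology R R Y 1)
    LinearMap.id) hRos
  simpa only [map_sum, TensorProduct.map_tmul, LinearEquiv.coe_coe, LinearEquiv.symm_apply_apply,
    LinearMap.id_coe, id_eq] using this.symm

end Summit.HodgeConjecture.CorCM.Model

end
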